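import Literature.AlgebraicGeometry.Resolution.SyzygyStaircase
import Literature.AlgebraicGeometry.Resolution.RegularLocalRingsProofs
import Mathlib.RingTheory.Localization.Finiteness
import Mathlib.RingTheory.Localization.Integer
import Mathlib.RingTheory.Support
import Mathlib.RingTheory.Ideal.Height
import HarnessLib

/-!
# The annihilators of `Ext^q(M, S)`, `q > ht 𝔭`, are not contained in `𝔭`

Topic: `Literature/AlgebraicGeometry/Resolution` (support half of the Ext-annihilator form of
Schenzel's theorem, `SecantColonAnnihilator.lean`; cf. [BrunsHerzog1998, Thm. 8.1.1]:
`dim M/𝔞ᵢM ≤ i`, i.e. the annihilators of the non-top local cohomology / `Ext` modules avoid the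
primes of large coheight).

Let `F` be a free resolution of finite type of a module `M` over a domain `R`, with dual
cohomology modules `E^q = F.EMod q` (`E^{q+1} = K_{q+1}^*/im(F_q^* → K_{q+1}^*) ≅ Ext^{q+1}(M,R)`),
and let `𝔭` be a prime.

* `FreeResolution.exists_smul_dual_mem_BSub` — if the syzygy `(K_q)_𝔭` of the localised resolution
  `F ⊗ R_𝔭` of `M_𝔭` is projective, then for every `ψ ∈ K_{q+1}^*` some `u ∉ 𝔭` has
  `uψ ∈ im(F_q^* → K_{q+1}^*)`: extend `ψ_𝔭` over the split injection `(K_{q+1})_𝔭 → (F_q)_𝔭` and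
  clear denominators.
* `FreeResolution.annihilator_EMod_not_le` — hence `Ann E^{q+1} ⊄ 𝔭` (`R` Noetherian).
* `prod_annihilator_EMod_not_le_of_height_le` — over a **regular local ring** `S`:
  `∏_{g < q ≤ N} Ann E^q ⊄ 𝔭` whenever `ht 𝔭 ≤ g`, because `S_𝔭` is regular of dimension `ht 𝔭`
  (Serre, Matsumura Thm. 19.3) so `pd M_𝔭 ≤ g` (Matsumura Thm. 19.2).

[cite: BrunsHerzog1998, Thm. 8.1.1; Matsumura1987, Thm. 19.2, Thm. 19.3]
-/

noncomputable section

open CategoryTheory IsLocalRing Module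

universe u

namespace Literature.AlgebraicGeometry.Resolution

/-! ## Localising linear forms on syzygies -/

namespace FreeResolution

variable {R : Type u} [CommRing R] {M : Type u} [AddCommGroup M] [Module R M]
variable (F : FreeResolution R M) (𝔭 : Ideal R) [𝔭.IsPrime]

/-- The localisation map `M → M_𝔭` is a base change to `R_𝔭`. [folklore] -/
theorem isBaseChange_mkLinearMap :
    IsBaseChange (Localization.AtPrime 𝔭) (LocalizedModule.mkLinearMap 𝔭.primeCompl M) :=
  (isLocalizedModule_iff_isBaseChange 𝔭.primeCompl (Localization.AtPrime 𝔭) _).mp inferInstance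

/-- The localised resolution `F ⊗ R_𝔭` of `M_𝔭`. [folklore] -/
abbrev localize : FreeResolution (Localization.AtPrime 𝔭) (LocalizedModule 𝔭.primeCompl M) :=
  F.baseChange (Localization.AtPrime 𝔭) (LocalizedModule.mkLinearMap 𝔭.primeCompl M)
    (isBaseChange_mkLinearMap 𝔭)

/-- `algebraMap` in each coordinate fixes the standard basis vectors. [folklore] -/
theorem piAlgebraMap_single (S : Type*) [CommRing S] [Algebra R S] {k : ℕ} (j : Fin k) :
    piAlgebraMap R S k (Pi.single j 1) = Pi.single j 1 := by
  ext l
  rw [piAlgebraMap_apply]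
  by_cases h : l = j
  · subst h; simp
  · simp [Pi.single_eq_of_ne h]

variable [IsDomain R]

/-- **Localising a linear form on a syzygy module.** If the `q`-th module `(K_q)_𝔭` of the
localised resolution is projective (so that `(K_{q+1})_𝔭 → (F_q)_𝔭` splits), then every linear
form `ψ : K_{q+1} → R` becomes, after multiplication by some `u ∉ 𝔭`, the restriction of a linear
form on `F_q`: `uψ ∈ B^{q+1} = im(F_q^* → K_{q+1}^*)`. (`R` a domain, so that `R → R_𝔭` is
injective.) [folklore] -/
theorem exists_smul_dual_mem_BSub (q : ℕ) (hproj : Projective ((F.localize 𝔭).syzygyObj q))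
    (ψ : Dual R (F.syzygyObj (q + 1))) : ∃ u ∉ 𝔭, u • ψ ∈ F.BSub (q + 1) := by
  classical
  set Rp := Localization.AtPrime 𝔭 with hRp
  set F' := F.localize 𝔭 with hF'
  haveI := hproj
  -- a retraction of `(K_{q+1})_𝔭 → (F_q)_𝔭`
  obtain ⟨r, hr⟩ := F'.exists_retraction_syzygyι q
  -- `ψ_𝔭 : (K_{q+1})_𝔭 → R_𝔭`
  have hη := F.isBaseChange_syzygyMap Rp (LocalizedModule.mkLinearMap 𝔭.primeCompl M)
    (isBaseChange_mkLinearMap 𝔭) q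
  let ψR : F.syzygy q →ₗ[R] Rp :=
    Algebra.linearMap R Rp ∘ₗ (ψ ∘ₗ (F.syzygySuccEquiv q).symm.toLinearMap)
  let ψ' : F'.syzygy q →ₗ[Rp] Rp := hη.lift ψR
  have hψ' : ∀ y : F.syzygy q,
      ψ' (F.syzygyMap Rp (LocalizedModule.mkLinearMap 𝔭.primeCompl M)
        (isBaseChange_mkLinearMap 𝔭) q y) =
        algebraMap R Rp (ψ ((F.syzygySuccEquiv q).symm y)) := fun y => hη.lift_eq ψR y
  -- `θ' = ψ_𝔭 ∘ r : (F_q)_𝔭 → R_𝔭`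
  obtain ⟨θ', hθ'⟩ : ∃ θ' : (Fin (F.rank q) → Rp) →ₗ[Rp] Rp,
      ∀ z : F'.syzygyObj (q + 1), θ' ((F'.syzygyι q).hom z) = ψ' (F'.syzygySuccEquiv q z) :=
    ⟨(ψ' ∘ₗ (F'.syzygySuccEquiv q).toLinearMap) ∘ₗ r, fun z => by
      change ψ' (F'.syzygySuccEquiv q (r ((F'.syzygyι q).hom z))) = _
      rw [hr z]⟩
  -- clear denominators in the values `θ'(eⱼ)`
  obtain ⟨u, hu⟩ := IsLocalization.exist_integer_multiples_of_finite 𝔭.primeCompl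
    (fun j : Fin (F.rank q) => θ' (Pi.single j 1))
  choose a ha using fun j => RingHom.mem_rangeS.mp (hu j)
  -- `φ : F_q → R` with `φ(eⱼ) = aⱼ`
  obtain ⟨φ, hφj⟩ : ∃ φ : (Fin (F.rank q) → R) →ₗ[R] R, ∀ j, φ (Pi.single j 1) = a j :=
    ⟨(Pi.basisFun R (Fin (F.rank q))).constr R a, fun j => by
      have h0 := (Pi.basisFun R (Fin (F.rank q))).constr_basis R a j
      rwa [Pi.basisFun_apply] at h0⟩
  have hφ : ∀ v : Fin (F.rank q) → R,
      algebraMap R Rp (φ v) = (u : R) • θ' (piAlgebraMap R Rp (F.rank q) v) := by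
    intro v
    have key : Algebra.linearMap R Rp ∘ₗ φ =
        (u : R) • (θ'.restrictScalars R ∘ₗ piAlgebraMap R Rp (F.rank q)) := by
      refine (Pi.basisFun R (Fin (F.rank q))).ext fun j => ?_
      simp only [LinearMap.comp_apply, Algebra.linearMap_apply, Pi.basisFun_apply, hφj, ha j,
        LinearMap.smul_apply, LinearMap.restrictScalars_apply, piAlgebraMap_single]
    exact LinearMap.congr_fun key v
  refine ⟨u, u.2, (F.mem_BSub_succ_iff q _).mpr ⟨φ, ?_⟩⟩
  ext y
  rw [dualRestrict_apply, LinearMap.smul_apply, smul_eq_mul]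
  -- compare in `R_𝔭`
  apply IsLocalization.injective Rp 𝔭.primeCompl_le_nonZeroDivisors
  rw [syzygyι_apply, hφ, map_mul]
  -- `θ'` on the image of `y`
  have h1 : piAlgebraMap R Rp (F.rank q) (F.syzygySuccEquiv q y : Fin (F.rank q) → R) =
      (F'.syzygyι q).hom ((F'.syzygySuccEquiv q).symm
        (F.syzygyMap Rp (LocalizedModule.mkLinearMap 𝔭.primeCompl M)
          (isBaseChange_mkLinearMap 𝔭) q (F.syzygySuccEquiv q y))) := rfl
  rw [h1, hθ', LinearEquiv.apply_symm_apply, hψ', LinearEquiv.symm_apply_apply, Algebra.smul_def]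

variable [IsNoetherianRing R]

/-- **`Ann E^{q+1} ⊄ 𝔭` when `(K_q)_𝔭` is projective**: every class in
`E^{q+1} = K_{q+1}^*/B^{q+1}` is killed by an element outside `𝔭`
(`exists_smul_dual_mem_BSub`), and `E^{q+1}` is finite. [folklore] -/
theorem annihilator_EMod_not_le (q : ℕ) (hproj : Projective ((F.localize 𝔭).syzygyObj q)) :
    ¬ Module.annihilator R (F.EMod (q + 1)) ≤ 𝔭 := by
  intro hle
  have hmem : (⟨𝔭, inferInstance⟩ : PrimeSpectrum R) ∈ Module.support R (F.EMod (q + 1)) :=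
    Module.mem_support_iff_of_finite.mpr hle
  refine Module.notMem_support_iff'.mpr (fun e => ?_) hmem
  induction e using Submodule.Quotient.induction_on with
  | H ψ =>
    obtain ⟨u, hu, hmemB⟩ := F.exists_smul_dual_mem_BSub 𝔭 q hproj ψ
    refine ⟨u, hu, ?_⟩
    rw [← Submodule.Quotient.mk_smul, Submodule.Quotient.mk_eq_zero]
    exact hmemB

end FreeResolution

/-! ## Over a regular local ring -/

section Regular

variable {S : Type u} [CommRing S] [IsRegularLocalRing S]
variable {M : Type u} [AddCommGroup M] [Module S M] [Module.Finite S M]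

/-- **The annihilators of `E^q ≅ Ext^q_S(M, S)`, `q > ht 𝔭`, avoid `𝔭`** (regular local `S`):
if `ht 𝔭 ≤ g` then `∏_{g < q ≤ N} Ann_S E^q ⊄ 𝔭`. Indeed `S_𝔭` is regular local of dimension
`ht 𝔭` (Matsumura Thm. 19.3), so `pd_{S_𝔭} M_𝔭 ≤ ht 𝔭 ≤ g` (Thm. 19.2) and the localised
syzygies `(K_q)_𝔭`, `q ≥ g`, are projective. [cite: BrunsHerzog1998, Thm. 8.1.1;
Matsumura1987, Thm. 19.3] -/
theorem prod_annihilator_EMod_not_le_of_height_le (F : FreeResolution S M) {g : ℕ} (N : ℕ)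
    (𝔭 : Ideal S) [𝔭.IsPrime] (h𝔭 : 𝔭.height ≤ g) :
    ¬ (∏ q ∈ Finset.Ioc g N, Module.annihilator S (F.EMod q)) ≤ 𝔭 := by
  haveI := isDomain_of_isRegularLocalRing S
  intro hle
  obtain ⟨q, hq, hq'⟩ := (Ideal.IsPrime.prod_le inferInstance).mp hle
  rw [Finset.mem_Ioc] at hq
  obtain ⟨q', rfl⟩ : ∃ q', q = q' + 1 := ⟨q - 1, by omega⟩
  refine F.annihilator_EMod_not_le 𝔭 q' ?_ hq'
  -- `pd_{S_𝔭} M_𝔭 ≤ ht 𝔭 ≤ g ≤ q'`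
  haveI : IsRegularLocalRing (Localization.AtPrime 𝔭) := isRegularLocalRing_localization_atPrime S 𝔭
  obtain ⟨xs, hxreg, hxspan, hxlen⟩ :=
    exists_isRegular_ofList_eq_maximalIdeal (R := Localization.AtPrime 𝔭)
  have hpd := hasProjectiveDimensionLE_length_of_isWeaklyRegular hxreg.toIsWeaklyRegular hxspan
    (ModuleCat.of (Localization.AtPrime 𝔭) (LocalizedModule 𝔭.primeCompl M))
  rw [IsLocalization.AtPrime.ringKrullDim_eq_height 𝔭 (Localization.AtPrime 𝔭)] at hxlen
  have hlen : (xs.length : ℕ∞) = 𝔭.height := by exact_mod_cast hxlen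
  have hle' : xs.length ≤ q' := by
    have : (xs.length : ℕ∞) ≤ g := hlen ▸ h𝔭
    have : xs.length ≤ g := by exact_mod_cast this
    omega
  haveI := hpd
  haveI : HasProjectiveDimensionLE
      (ModuleCat.of (Localization.AtPrime 𝔭) (LocalizedModule 𝔭.primeCompl M)) q' :=
    hasProjectiveDimensionLT_of_ge _ (xs.length + 1) (q' + 1) (by omega)
  exact (F.localize 𝔭).projective_syzygyObj_of_hasProjectiveDimensionLE this q' le_rfl

end Regular

end Literature.AlgebraicGeometry.Resolution

end
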